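import Mathlib
import Literature.NumberTheory.Sieve.IwaniecAlmostPrimesProp2Prep
import Literature.NumberTheory.Sieve.FriedlanderIwaniecPrimes
import HarnessLib

/-!
# Finite Fourier expansion of the weighted root count modulo `q` (helper toward
`stub_poissonReduction`, line `cofactor-root-discrepancy`, crux `SplitBlockJacobi`,
stmt-Parity-11583)

For an odd modulus `q`, a finite set `S ⊆ ℕ` and a weight `w : ℕ → ℂ` we prove the EXACT
identity (finite Fourier analysis on `ℤ/qℤ`, no analysis)

`Σ_{t ∈ S, q ∣ t²+1} w(t) = (1/q) Σ_{|h| ≤ (q-1)/2} ŵ_q(h) · S(-h, q)`,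

where `ŵ_q(h) = Σ_{t ∈ S} w(t) e(ht/q)` and `S(h, q) = Σ_{ν mod q, ν² ≡ -1} e(hν/q)` is the root
Weyl sum (written out; it is literally `rootWeylSum (-h) q` of the line's skeleton), together with
the version with the zero frequency `(1/q) · (Σ_t w(t)) · ρ(q)` moved to the left, and
`ρ(QQ′) = 4` for distinct primes `Q ≡ Q′ ≡ 1 (mod 4)`.

Ingredients: the orthogonality relation `Σ_{|h| ≤ H₀} e(hk/q) = q·[q ∣ k]` (`q = 2H₀+1`, from
`geom_sum_eq` and `Complex.exp_eq_one_iff`), the fact that `t ↦ t mod q` is the unique root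
`ν (mod q)` with `ν ≡ t` when `q ∣ t² + 1`, and the tree's `rho_mul_of_coprime`,
`card_zmod_sq_add_one_eq`.
-/

noncomputable section

open Finset

namespace Summit.Parity.BatemanHorn.Cruxes.SplitBlockJacobi.CofactorRootDiscrepancy.Poisson

/-! ### Orthogonality of additive characters over a symmetric complete residue system -/

/-- `e(hk/q) = e(k/q)^h`-type bookkeeping: the exponential at an integer shift `a + j`. -/
theorem exp_int_add_nat_mul (q : ℕ) (k a : ℤ) (j : ℕ) :
    Complex.exp (2 * Real.pi * Complex.I * ((a + (j : ℤ) : ℤ) : ℂ) * (k : ℂ) / (q : ℂ)) =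
      Complex.exp (2 * Real.pi * Complex.I * (a : ℂ) * (k : ℂ) / (q : ℂ)) *
        Complex.exp (2 * Real.pi * Complex.I * (k : ℂ) / (q : ℂ)) ^ j := by
  rw [← Complex.exp_nat_mul, ← Complex.exp_add]
  congr 1
  push_cast
  ring

/-- **Orthogonality.** For `q = 2H₀ + 1` and `k ∈ ℤ`:
`Σ_{h = -H₀}^{H₀} e(hk/q) = q` if `q ∣ k` and `= 0` otherwise. -/
theorem sum_Icc_exp_eq_ite (H₀ : ℕ) (k : ℤ) :
    ∑ h ∈ Finset.Icc (-(H₀ : ℤ)) (H₀ : ℤ),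
        Complex.exp (2 * Real.pi * Complex.I * (h : ℂ) * (k : ℂ) / ((2 * H₀ + 1 : ℕ) : ℂ)) =
      if ((2 * H₀ + 1 : ℕ) : ℤ) ∣ k then ((2 * H₀ + 1 : ℕ) : ℂ) else 0 := by
  set q : ℕ := 2 * H₀ + 1 with hq
  have hq0 : (q : ℂ) ≠ 0 := Nat.cast_ne_zero.mpr (by rw [hq]; omega)
  have hcard : ((H₀ : ℤ) + 1 - -(H₀ : ℤ)).toNat = q := by
    rw [hq]; omega
  rw [Int.Icc_eq_finset_map, Finset.sum_map, hcard]
  simp only [Function.Embedding.trans_apply, Nat.castEmbedding_apply, addLeftEmbedding_apply]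
  simp_rw [exp_int_add_nat_mul q k (-(H₀ : ℤ))]
  rw [← Finset.mul_sum]
  set z : ℂ := Complex.exp (2 * Real.pi * Complex.I * (k : ℂ) / (q : ℂ)) with hz
  have hzq : z ^ q = 1 := by
    rw [hz, ← Complex.exp_nat_mul]
    have : (q : ℂ) * (2 * Real.pi * Complex.I * (k : ℂ) / (q : ℂ)) =
        (k : ℂ) * (2 * Real.pi * Complex.I) := by
      field_simp
    rw [this]
    exact Complex.exp_int_mul_two_pi_mul_I k
  by_cases hdvd : (q : ℤ) ∣ k
  · rw [if_pos hdvd]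
    obtain ⟨m, hm⟩ := hdvd
    have hz1 : z = 1 := by
      rw [hz, hm]
      push_cast
      have : 2 * (Real.pi : ℂ) * Complex.I * ((q : ℂ) * (m : ℂ)) / (q : ℂ) =
          (m : ℂ) * (2 * Real.pi * Complex.I) := by
        field_simp
      rw [this]
      exact Complex.exp_int_mul_two_pi_mul_I m
    have hpre : Complex.exp (2 * Real.pi * Complex.I * ((-(H₀ : ℤ) : ℤ) : ℂ) * (k : ℂ) / (q : ℂ)) = 1 := by
      rw [hm]
      push_cast
      have : 2 * (Real.pi : ℂ) * Complex.I * (-(H₀ : ℂ)) * ((q : ℂ) * (m : ℂ)) / (q : ℂ) =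
          ((-(H₀ : ℤ) * m : ℤ) : ℂ) * (2 * Real.pi * Complex.I) := by
        push_cast
        field_simp
      rw [this]
      exact Complex.exp_int_mul_two_pi_mul_I _
    rw [hpre, one_mul]
    simp [hz1]
  · rw [if_neg hdvd]
    have hz1 : z ≠ 1 := by
      intro h1
      rw [hz, Complex.exp_eq_one_iff] at h1
      obtain ⟨n, hn⟩ := h1
      apply hdvd
      have h2pi : (2 * Real.pi * Complex.I : ℂ) ≠ 0 := by
        simp [Real.pi_ne_zero, Complex.I_ne_zero]
      have hk : (k : ℂ) = (n : ℂ) * (q : ℂ) := by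
        rw [div_eq_iff hq0] at hn
        apply mul_left_cancel₀ h2pi
        linear_combination hn
      refine ⟨n, ?_⟩
      have : (k : ℂ) = ((q * n : ℤ) : ℂ) := by rw [hk]; push_cast; ring
      exact_mod_cast this
    rw [geom_sum_eq hz1, hzq]
    simp


/-! ### The unique root congruent to `t` -/

/-- If `q ∣ t² + 1` (`q ≥ 1`), the roots `ν (mod q)` of `ν² ≡ -1` with `ν ≡ t (mod q)` are exactly
`{t mod q}`; otherwise there is none. Stated as a cardinality. -/
theorem card_roots_congr_eq_ite (q : ℕ) (hq : 0 < q) (t : ℕ) :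
    (((Finset.range q).filter (fun ν : ℕ => q ∣ ν ^ 2 + 1)).filter
        (fun ν : ℕ => (q : ℤ) ∣ (t : ℤ) - (ν : ℤ))).card = if q ∣ t ^ 2 + 1 then 1 else 0 := by
  -- `(q : ℤ) ∣ t - ν` with `ν < q` means `ν = t % q`
  have key : ∀ ν : ℕ, ν < q → ((q : ℤ) ∣ (t : ℤ) - (ν : ℤ) ↔ ν = t % q) := by
    intro ν hν
    have e : (t : ℤ) - (ν : ℤ) = -((ν : ℤ) - (t : ℤ)) := by ring
    rw [e, dvd_neg, ← Nat.modEq_iff_dvd]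
    -- goal: t ≡ ν [MOD q] ↔ ν = t % q
    constructor
    · intro h
      have h' : t % q = ν % q := h
      rw [Nat.mod_eq_of_lt hν] at h'
      exact h'.symm
    · intro h
      rw [h]
      exact (Nat.mod_modEq t q).symm
  have hmod : ∀ ν : ℕ, ν = t % q → (q ∣ ν ^ 2 + 1 ↔ q ∣ t ^ 2 + 1) := by
    intro ν h
    subst h
    have hm : (t % q) ^ 2 + 1 ≡ t ^ 2 + 1 [MOD q] := ((Nat.mod_modEq t q).pow 2).add_right 1
    rw [← Nat.modEq_zero_iff_dvd, ← Nat.modEq_zero_iff_dvd]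
    exact ⟨fun h => hm.symm.trans h, fun h => hm.trans h⟩
  rw [Finset.filter_filter]
  split_ifs with hdvd
  · rw [Finset.card_eq_one]
    refine ⟨t % q, ?_⟩
    ext ν
    simp only [Finset.mem_filter, Finset.mem_range, Finset.mem_singleton]
    constructor
    · rintro ⟨hν, -, hd⟩
      exact (key ν hν).mp hd
    · intro h
      have hν : ν < q := h ▸ Nat.mod_lt t hq
      exact ⟨hν, (hmod ν h).mpr hdvd, (key ν hν).mpr h⟩
  · rw [Finset.card_eq_zero, Finset.filter_eq_empty_iff]
    rintro ν hν ⟨hd1, hd2⟩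
    rw [Finset.mem_range] at hν
    have h := (key ν hν).mp hd2
    exact hdvd ((hmod ν h).mp hd1)

/-! ### The identity -/

/-- **Finite Fourier expansion of the weighted root count** (exact). For odd `q`, a finite
`S ⊆ ℕ` and `w : ℕ → ℂ`:
`Σ_{t ∈ S, q ∣ t²+1} w(t) = (1/q) Σ_{h=-(q-1)/2}^{(q-1)/2} (Σ_{t∈S} w(t) e(ht/q)) · S(-h, q)`,
`S(-h, q) = Σ_{ν < q, q ∣ ν²+1} e(-hν/q)` (the skeleton's `rootWeylSum (-h) q`, verbatim). -/
theorem sum_filter_dvd_eq_fourier (q : ℕ) (hq : q % 2 = 1) (S : Finset ℕ) (w : ℕ → ℂ) :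
    ∑ t ∈ S.filter (fun t : ℕ => q ∣ t ^ 2 + 1), w t =
      (1 / (q : ℂ)) * ∑ h ∈ Finset.Icc (-((q / 2 : ℕ) : ℤ)) ((q / 2 : ℕ) : ℤ),
        (∑ t ∈ S, w t * Complex.exp (2 * Real.pi * Complex.I * (h : ℂ) * (t : ℂ) / (q : ℂ))) *
          ∑ ν ∈ (Finset.range q).filter (fun ν : ℕ => q ∣ ν ^ 2 + 1),
            Complex.exp (2 * Real.pi * Complex.I * ((-h : ℤ) : ℂ) * (ν : ℂ) / (q : ℂ)) := by
  set H₀ : ℕ := q / 2 with hH₀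
  have hqH : q = 2 * H₀ + 1 := by omega
  have hq0 : 0 < q := by omega
  have hqC : (q : ℂ) ≠ 0 := Nat.cast_ne_zero.mpr hq0.ne'
  set R := (Finset.range q).filter (fun ν : ℕ => q ∣ ν ^ 2 + 1) with hR
  -- expand the product of sums into a double sum with combined exponentials
  have h1 : ∀ h : ℤ,
      (∑ t ∈ S, w t * Complex.exp (2 * Real.pi * Complex.I * (h : ℂ) * (t : ℂ) / (q : ℂ))) *
          ∑ ν ∈ R, Complex.exp (2 * Real.pi * Complex.I * ((-h : ℤ) : ℂ) * (ν : ℂ) / (q : ℂ)) =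
        ∑ t ∈ S, ∑ ν ∈ R, w t *
          Complex.exp (2 * Real.pi * Complex.I * (h : ℂ) * (((t : ℤ) - (ν : ℤ) : ℤ) : ℂ) / (q : ℂ)) := by
    intro h
    rw [Finset.sum_mul_sum]
    refine Finset.sum_congr rfl fun t _ => Finset.sum_congr rfl fun ν _ => ?_
    rw [mul_assoc, ← Complex.exp_add]
    congr 2
    push_cast
    ring
  simp_rw [h1]
  rw [Finset.sum_comm]
  -- now `Σ_t Σ_h Σ_ν`; swap the inner two and use orthogonality
  have h2 : ∀ t ∈ S,
      ∑ h ∈ Finset.Icc (-(H₀ : ℤ)) (H₀ : ℤ), ∑ ν ∈ R, w t *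
          Complex.exp (2 * Real.pi * Complex.I * (h : ℂ) * (((t : ℤ) - (ν : ℤ) : ℤ) : ℂ) / (q : ℂ)) =
        w t * (q : ℂ) * (if q ∣ t ^ 2 + 1 then 1 else 0) := by
    intro t _
    rw [Finset.sum_comm]
    have h3 : ∀ ν ∈ R, ∑ h ∈ Finset.Icc (-(H₀ : ℤ)) (H₀ : ℤ), w t *
        Complex.exp (2 * Real.pi * Complex.I * (h : ℂ) * (((t : ℤ) - (ν : ℤ) : ℤ) : ℂ) / (q : ℂ)) =
          w t * (if (q : ℤ) ∣ (t : ℤ) - (ν : ℤ) then (q : ℂ) else 0) := by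
      intro ν _
      rw [← Finset.mul_sum, hqH]
      congr 1
      exact_mod_cast sum_Icc_exp_eq_ite H₀ ((t : ℤ) - (ν : ℤ))
    rw [Finset.sum_congr rfl h3, ← Finset.mul_sum, ← Finset.sum_filter, Finset.sum_const,
      nsmul_eq_mul, card_roots_congr_eq_ite q hq0 t]
    split_ifs
    · push_cast; ring
    · push_cast; ring
  rw [Finset.sum_congr rfl h2, Finset.mul_sum, Finset.sum_filter]
  refine Finset.sum_congr rfl fun t _ => ?_
  split_ifs
  · field_simp
  · simp

/-- **The same identity with the zero frequency moved to the left**: for odd `q`,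
`Σ_{t ∈ S, q∣t²+1} w(t) − (1/q)(Σ_{t∈S} w(t))·ρ(q) = (1/q) Σ_{0 < |h| ≤ (q-1)/2} ŵ_q(h) S(-h,q)`,
where `ρ(q) = #{ν < q : q ∣ ν² + 1}`. -/
theorem sum_filter_dvd_sub_main_eq_fourier (q : ℕ) (hq : q % 2 = 1) (S : Finset ℕ) (w : ℕ → ℂ) :
    ∑ t ∈ S.filter (fun t : ℕ => q ∣ t ^ 2 + 1), w t -
        (1 / (q : ℂ)) * (∑ t ∈ S, w t) *
          (((Finset.range q).filter (fun ν : ℕ => q ∣ ν ^ 2 + 1)).card : ℂ) =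
      (1 / (q : ℂ)) * ∑ h ∈ (Finset.Icc (-((q / 2 : ℕ) : ℤ)) ((q / 2 : ℕ) : ℤ)).filter
          (fun h : ℤ => h ≠ 0),
        (∑ t ∈ S, w t * Complex.exp (2 * Real.pi * Complex.I * (h : ℂ) * (t : ℂ) / (q : ℂ))) *
          ∑ ν ∈ (Finset.range q).filter (fun ν : ℕ => q ∣ ν ^ 2 + 1),
            Complex.exp (2 * Real.pi * Complex.I * ((-h : ℤ) : ℂ) * (ν : ℂ) / (q : ℂ)) := by
  rw [sum_filter_dvd_eq_fourier q hq S w]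
  have h0 : (0 : ℤ) ∈ Finset.Icc (-((q / 2 : ℕ) : ℤ)) ((q / 2 : ℕ) : ℤ) := by
    simp only [Finset.mem_Icc, Left.neg_nonpos_iff]
    exact ⟨by positivity, by positivity⟩
  rw [← Finset.add_sum_erase _ _ h0, Finset.filter_ne']
  simp only [Int.cast_zero, neg_zero, mul_zero, zero_mul, zero_div, Complex.exp_zero, mul_one,
    Finset.sum_const, nsmul_eq_mul]
  ring

/-! ### `ρ(QQ′) = 4` -/

/-- For a prime `Q ≡ 1 (mod 4)`, `-1` has exactly two square roots modulo `Q`: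
`#{ν < Q : Q ∣ ν² + 1} = 2`. -/
theorem card_roots_prime_eq_two {Q : ℕ} (hQ : Q.Prime) (hQ4 : Q % 4 = 1) :
    ((Finset.range Q).filter (fun ν : ℕ => Q ∣ ν ^ 2 + 1)).card = 2 := by
  haveI : Fact Q.Prime := ⟨hQ⟩
  have hQ2 : Q ≠ 2 := by omega
  have h := Literature.NumberTheory.Sieve.fiRho_eq_card_zmod Q
  rw [Literature.NumberTheory.Sieve.card_zmod_sq_add_one_eq hQ2, if_pos hQ4] at h
  exact h

/-- **`ρ(QQ′) = 4`**: for distinct primes `Q, Q′ ≡ 1 (mod 4)`,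
`#{ν < QQ′ : QQ′ ∣ ν² + 1} = 4` (Chinese remainder theorem and two roots modulo each prime). -/
theorem card_roots_mul_eq_four {Q Q' : ℕ} (hQ : Q.Prime) (hQ' : Q'.Prime) (hQ4 : Q % 4 = 1)
    (hQ'4 : Q' % 4 = 1) (hne : Q ≠ Q') :
    ((Finset.range (Q * Q')).filter (fun ν : ℕ => Q * Q' ∣ ν ^ 2 + 1)).card = 4 := by
  have hcop : Q.Coprime Q' := (Nat.coprime_primes hQ hQ').mpr hne
  have h := Literature.NumberTheory.Sieve.Iwaniec1978.rho_mul_of_coprime hQ.ne_zero hQ'.ne_zero hcop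
  have h1 : Literature.NumberTheory.Sieve.Iwaniec1978.rho Q = 2 := card_roots_prime_eq_two hQ hQ4
  have h2 : Literature.NumberTheory.Sieve.Iwaniec1978.rho Q' = 2 := card_roots_prime_eq_two hQ' hQ'4
  rw [h1, h2] at h
  exact h

/-- The trivial bound for the root Weyl sum: `|S(h, q)| ≤ ρ(q)` (unimodular terms). -/
theorem norm_rootWeylSum_le (q : ℕ) (h : ℤ) :
    ‖∑ ν ∈ (Finset.range q).filter (fun ν : ℕ => q ∣ ν ^ 2 + 1),
        Complex.exp (2 * Real.pi * Complex.I * (h : ℂ) * (ν : ℂ) / (q : ℂ))‖ ≤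
      (((Finset.range q).filter (fun ν : ℕ => q ∣ ν ^ 2 + 1)).card : ℝ) := by
  refine (norm_sum_le _ _).trans ?_
  refine (Finset.sum_le_card_nsmul _ _ 1 fun ν _ => ?_).trans (by simp)
  rw [Complex.norm_exp]
  apply le_of_eq
  rw [show (2 * ↑Real.pi * Complex.I * (h : ℂ) * (ν : ℂ) / (q : ℂ)) =
      ((2 * Real.pi * h * ν / q : ℝ) : ℂ) * Complex.I by push_cast; ring]
  simp [Complex.mul_re]

/-- For distinct primes `Q, Q′ ≡ 1 (mod 4)`: `|S(h, QQ′)| ≤ 4`. -/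
theorem norm_rootWeylSum_mul_le_four {Q Q' : ℕ} (hQ : Q.Prime) (hQ' : Q'.Prime) (hQ4 : Q % 4 = 1)
    (hQ'4 : Q' % 4 = 1) (hne : Q ≠ Q') (h : ℤ) :
    ‖∑ ν ∈ (Finset.range (Q * Q')).filter (fun ν : ℕ => Q * Q' ∣ ν ^ 2 + 1),
        Complex.exp (2 * Real.pi * Complex.I * (h : ℂ) * (ν : ℂ) / ((Q * Q' : ℕ) : ℂ))‖ ≤ 4 := by
  have h4 := card_roots_mul_eq_four hQ hQ' hQ4 hQ'4 hne
  have := norm_rootWeylSum_le (Q * Q') h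
  rw [h4] at this
  exact_mod_cast this

end Summit.Parity.BatemanHorn.Cruxes.SplitBlockJacobi.CofactorRootDiscrepancy.Poisson

namespace Summit.Parity.BatemanHorn.Cruxes.SplitBlockJacobi.CofactorRootDiscrepancy

/-- **Registered stub form** of `Poisson.sum_filter_dvd_sub_main_eq_fourier`: the identical statement, declared in the crux
namespace under the name registered on stmt-Parity-11583 (`ledger workitem stub-add`). -/
theorem sum_filter_dvd_sub_main_eq_fourier :
    ∀ (q : ℕ) (hq : q % 2 = 1) (S : Finset ℕ) (w : ℕ → ℂ), ∑ t ∈ S.filter (fun t : ℕ => q ∣ t ^ 2 + 1), w t - (1 / (q : ℂ)) * (∑ t ∈ S, w t) * (((Finset.range q).filter (fun ν : ℕ => q ∣ ν ^ 2 + 1)).card : ℂ) = (1 / (q : ℂ)) * ∑ h ∈ (Finset.Icc (-((q / 2 : ℕ) : ℤ)) ((q / 2 : ℕ) : ℤ)).filter (fun h : ℤ => h ≠ 0), (∑ t ∈ S, w t * Complex.exp (2 * Real.pi * Complex.I * (h : ℂ) * (t : ℂ) / (q : ℂ))) * ∑ ν ∈ (Finset.range q).filter (fun ν : ℕ => q ∣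 ν ^ 2 + 1), Complex.exp (2 * Real.pi * Complex.I * ((-h : ℤ) : ℂ) * (ν : ℂ) / (q : ℂ)) :=
  @Poisson.sum_filter_dvd_sub_main_eq_fourier

end Summit.Parity.BatemanHorn.Cruxes.SplitBlockJacobi.CofactorRootDiscrepancy

end
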